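import Summits.QuantumFields.YangMills.Theorems.AllWindowsColdBoxBoxHighLineTiltCum4Bound
import Summits.QuantumFields.YangMills.Theorems.AllWindowsColdBoxBoxHighLineSmallFieldInsideFPByName
import Summits.QuantumFields.YangMills.Theorems.AllWindowsColdBoxBoxHighLineSmallFieldMass

/-!
# T-S5.13K-K4 in the v13 window — `κ₄,t` over `μ_D` with EVERY hypothesis discharged in the ASSEMBLY-S5 §1 letters
# (LINE-19 S5 ⟨stmt-QuantumFields-24004⟩/⟨24335⟩; for the final bookkeeping file of `stub_landauSecondOrder` v13, hands = w3 g40 under LEAD sfw-p2 g77)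

Width seat `ym-line-sfw-p2-w5` (prover-ym-line-sfw-p2-w5-g23-0).  ✓`GaussNormalForm.abs_tiltCum4_muD_le_rpow` (this seat, p746145) bounds the fourth
tilted cumulant by three monomials under five hypotheses (`H⁴ ≤ β`, `s·H² ≤ c₀`, `κ₃ ≤ 1/6`, `sup_D|tiltU| ≤ 1`, `E₀[1_D] ≥ 1/2`, `s = β^{−1/2+κ₃}`).
Here all five are discharged for `β ≥ β₀(θ, κ₃)` uniformly in the window `1 ≤ H ≤ β^θ + 1`, from `0 < θ`, `12θ < 1`, `0 < κ₃ < (1/2 − 4θ)/3`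
(the §1 (a) constraint), BY NAME: ✓`ErrorBudget.exists_forall_natPow_log_le` (w2 g31; `H⁴ ≤ β`, `H²β^{−1/2+κ₃} ≤ c₀`), ✓`TiltSup.exists_forall_abs_tiltU_le_one`
(w4 g28, over ✓7d), ✓`GaussTail.exists_beta0_half_le_gaussAvg_sfInd` (w3 g40, over ✓6g):

* ★★ `GaussNormalForm.exists_beta0_abs_tiltCum4_muD_le` —
  `∃ C m, 0 ≤ C ∧ ∃ β₀ ≥ 1, ∀ β ≥ β₀, ∀ H, 1 ≤ H → H ≤ β^θ + 1 → ∀ x y, ∀ t ∈ [0,1],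
   |κ₄,t(c_x, c_y; tiltU, tiltU)| ≤ C·(1+log H)^m·(2·H⁴/β³ + 8·H⁸·β^{−4+4κ₃} + 4·H¹²·β^{−5+10κ₃})`
  over `μ_D` at `s = β^{−1/2+κ₃}` — the `hK` of ✓13u `abs_tiltCov_sub_sub_tiltCum3_le_muD` with nothing left to check but `β ≥ β₀`;
* ★★★ `GaussNormalForm.exists_beta0_abs_tiltCov_sub_sub_tiltCum3_le` — E2-memo STEPS 2+3 composed: `|Cov₁ − Cov₀ − κ₃,₀| ≤ K/2` over `μ_D` for the
  plaquette costs `c_x, c_y`, with that explicit `K` and every hypothesis of ✓13u discharged (`B = 4`), for `β ≥ β₀`, `1 ≤ H ≤ β^θ + 1`.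

Everything proved; no definitions; standard axioms.  HONEST LABEL: a support brick for the OPEN assembly T-S5.13 of the XL stub S5 of a critic-PASSed
DRAFT line; S5, U5, ⟨24004⟩ ⟨24335⟩ ⟨24336⟩ remain OPEN; no crux, rung or summit is proved; **the Yang–Mills mass gap is NOT proved by this file;
no summit is proved by a line.**
-/

set_option autoImplicit false

noncomputable section

open MeasureTheory Set Real
open Literature.Probability.LatticeModels (Site)

namespace Summit.QuantumFields.YangMills.Theorems.AllWindowsColdBoxBoxHighLine

namespace GaussNormalForm

/-- ★★ **`κ₄,t` over `μ_D` in the v13 window, all hypotheses discharged**: for `0 < θ`, `12θ < 1`, `0 < κ₃ < (1/2 − 4θ)/3` there are `C ≥ 0`, `m`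
and `β₀ ≥ 1` such that for `β ≥ β₀`, `1 ≤ H ≤ β^θ + 1`, all base points `x, y` and `t ∈ [0,1]`, with `s = β^{−1/2+κ₃}`:
`|κ₄,t(c_x, c_y; tiltU, tiltU)| ≤ C·(1+log H)^m·(2·H⁴/β³ + 8·H⁸·β^{−4+4κ₃} + 4·H¹²·β^{−5+10κ₃})`. -/
theorem exists_beta0_abs_tiltCum4_muD_le {θ κ₃ : ℝ} (hθ : 0 < θ) (h12 : 12 * θ < 1) (hκ0 : 0 < κ₃) (hκu : κ₃ < (1 / 2 - 4 * θ) / 3) :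
    ∃ C : ℝ, ∃ m : ℕ, 0 ≤ C ∧ ∃ β₀ : ℝ, 1 ≤ β₀ ∧ ∀ β : ℝ, β₀ ≤ β → ∀ H : ℕ, 1 ≤ H → (H : ℝ) ≤ β ^ θ + 1 →
      ∀ (x y : Site 4), ∀ t ∈ Set.Icc (0 : ℝ) 1,
        |Tilt.tiltCum4 ((volume.restrict (smallField H (β ^ (-1 / 2 + κ₃)))).withDensity fun a => ENNReal.ofReal (gaussWeight β H a))
            (tiltU β H) t (chartPlaqCost H x 1 2) (chartPlaqCost H y 1 2)| ≤
          C * (1 + Real.log H) ^ m *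
            (2 * ((H : ℝ) ^ 4 / β ^ 3) + 8 * ((H : ℝ) ^ 8 * β ^ (-4 + 4 * κ₃)) + 4 * ((H : ℝ) ^ 12 * β ^ (-5 + 10 * κ₃))) := by
  obtain ⟨C, c₀, m, hc₀, hC, hK⟩ := abs_tiltCum4_muD_le_rpow
  -- the four largeness conditions
  obtain ⟨b₁, hb₁1, hb₁⟩ := ErrorBudget.exists_forall_natPow_log_le (k := 4) (γ := 1) hθ.le (by push_cast; linarith) one_pos 1 0 0
  obtain ⟨b₂, hb₂1, hb₂⟩ := ErrorBudget.exists_forall_natPow_log_le (k := 2) (γ := 1 / 2 - κ₃) hθ.le (by push_cast; linarith) hc₀ 1 0 0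
  obtain ⟨b₃, hb₃1, hb₃⟩ := TiltSup.exists_forall_abs_tiltU_le_one hθ h12 hκu
  obtain ⟨b₄, hb₄1, hb₄⟩ := GaussTail.exists_beta0_half_le_gaussAvg_sfInd hθ.le hκ0
  refine ⟨C, m, hC, max (max b₁ b₂) (max b₃ b₄), le_max_of_le_left (le_max_of_le_left hb₁1), fun β hβ H hH hHu x y t ht => ?_⟩
  simp only [max_le_iff] at hβ
  obtain ⟨⟨hβ1, hβ2⟩, hβ3, hβ4⟩ := hβ
  have hβ0 : 0 < β := lt_of_lt_of_le one_pos (hb₁1.trans hβ1)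
  -- `H⁴ ≤ β`
  have h1 := hb₁ β hβ1 H hH hHu
  simp only [pow_zero, mul_one, one_mul, Real.rpow_one] at h1
  have hH4 : (H : ℝ) ^ 4 ≤ β := by rwa [div_le_one hβ0] at h1
  -- `s·H² ≤ c₀`
  have h2 := hb₂ β hβ2 H hH hHu
  simp only [pow_zero, mul_one, one_mul] at h2
  have hsH : β ^ (-1 / 2 + κ₃) * (H : ℝ) ^ 2 ≤ c₀ := by
    rw [TiltSup.rpow_eq_one_div hβ0, one_div_mul_eq_div]
    exact h2
  -- `sup_D |tiltU| ≤ 1` and `E₀[1_D] ≥ 1/2`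
  have hU1 := hb₃ β hβ3 H hH hHu
  have hD := (hb₄ β hβ4 H hH hHu).1
  rw [show κ₃ - 1 / 2 = -1 / 2 + κ₃ by ring] at hD
  have hκ6 : κ₃ ≤ 1 / 6 := by linarith
  exact hK H hH β hH4 κ₃ hκ0.le hκ6 hsH hU1 hD x y t ht

/-- ★★★ **E2-memo STEPS 2+3 in one line: `|Cov₁ − Cov₀ − κ₃,₀| ≤ K/2` over `μ_D` with the explicit `K` of ✓`abs_tiltCum4_muD_le_rpow`, every
hypothesis discharged in the v13 window** (✓13u `abs_tiltCov_sub_sub_tiltCum3_le_muD` with `B = 4`: ✓`TiltSup.abs_chartPlaqCost_le_four`,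
`|tiltU| ≤ 1 ≤ 4` on `D`; `s = β^{−1/2+κ₃} > 0`): for `0 < θ`, `12θ < 1`, `0 < κ₃ < (1/2 − 4θ)/3` there are `C ≥ 0`, `m`, `β₀ ≥ 1` with
`|tiltCov μ_D U 1 c_x c_y − tiltCov μ_D U 0 c_x c_y − tiltCum3 μ_D U 0 c_x c_y| ≤ C·(1+log H)^m·(2H⁴/β³ + 8H⁸β^{−4+4κ₃} + 4H¹²β^{−5+10κ₃}) / 2`
for `β ≥ β₀`, `1 ≤ H ≤ β^θ + 1`, all base points `x, y` (`U = tiltU β H`, `c_z = chartPlaqCost H z 1 2`). -/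
theorem exists_beta0_abs_tiltCov_sub_sub_tiltCum3_le {θ κ₃ : ℝ} (hθ : 0 < θ) (h12 : 12 * θ < 1) (hκ0 : 0 < κ₃)
    (hκu : κ₃ < (1 / 2 - 4 * θ) / 3) :
    ∃ C : ℝ, ∃ m : ℕ, 0 ≤ C ∧ ∃ β₀ : ℝ, 1 ≤ β₀ ∧ ∀ β : ℝ, β₀ ≤ β → ∀ H : ℕ, 1 ≤ H → (H : ℝ) ≤ β ^ θ + 1 → ∀ (x y : Site 4),
      |Tilt.tiltCov ((volume.restrict (smallField H (β ^ (-1 / 2 + κ₃)))).withDensity fun a => ENNReal.ofReal (gaussWeight β H a))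
            (tiltU β H) 1 (chartPlaqCost H x 1 2) (chartPlaqCost H y 1 2) -
          Tilt.tiltCov ((volume.restrict (smallField H (β ^ (-1 / 2 + κ₃)))).withDensity fun a => ENNReal.ofReal (gaussWeight β H a))
            (tiltU β H) 0 (chartPlaqCost H x 1 2) (chartPlaqCost H y 1 2) -
          Tilt.tiltCum3 ((volume.restrict (smallField H (β ^ (-1 / 2 + κ₃)))).withDensity fun a => ENNReal.ofReal (gaussWeight β H a))
            (tiltU β H) 0 (chartPlaqCost H x 1 2) (chartPlaqCost H y 1 2)| ≤
        C * (1 + Real.log H) ^ m *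
            (2 * ((H : ℝ) ^ 4 / β ^ 3) + 8 * ((H : ℝ) ^ 8 * β ^ (-4 + 4 * κ₃)) + 4 * ((H : ℝ) ^ 12 * β ^ (-5 + 10 * κ₃))) / 2 := by
  obtain ⟨C, m, hC, β₀, hβ₀, hK⟩ := exists_beta0_abs_tiltCum4_muD_le hθ h12 hκ0 hκu
  obtain ⟨b₃, hb₃1, hb₃⟩ := TiltSup.exists_forall_abs_tiltU_le_one hθ h12 hκu
  refine ⟨C, m, hC, max β₀ b₃, le_max_of_le_left hβ₀, fun β hβ H hH hHu x y => ?_⟩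
  have hβ1 : β₀ ≤ β := (le_max_left _ _).trans hβ
  have hβ3 : b₃ ≤ β := (le_max_right _ _).trans hβ
  have hβ0 : 0 < β := lt_of_lt_of_le one_pos (hβ₀.trans hβ1)
  have hs : 0 < β ^ (-1 / 2 + κ₃) := Real.rpow_pos_of_pos hβ0 _
  have hU4 : ∀ a ∈ smallField H (β ^ (-1 / 2 + κ₃)), |tiltU β H a| ≤ 4 := fun a ha =>
    (hb₃ β hβ3 H hH hHu a ha).trans (by norm_num)
  exact abs_tiltCov_sub_sub_tiltCum3_le_muD hβ0 hs (EdgeChartGaussian.measurable_chartPlaqCost H x 1 2)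
    (EdgeChartGaussian.measurable_chartPlaqCost H y 1 2) (fun a => TiltSup.abs_chartPlaqCost_le_four (H := H) x 1 2 a)
    (fun a => TiltSup.abs_chartPlaqCost_le_four (H := H) y 1 2 a) hU4 (hK β hβ1 H hH hHu x y)

end GaussNormalForm

end Summit.QuantumFields.YangMills.Theorems.AllWindowsColdBoxBoxHighLine

end
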